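import Summits.CriticalPhenomena.PercolationContinuityZ3.Theorems.PercNearOneGluingNoHeavyLowerTailSahiCombTriWIdxSplit

/-!
# The MIXED index split of `TRI_W`: `TRI_a(F,G) = TRI_{a−1}(F⁰,G¹) + TRI_{a−1}(F¹,G⁰) + Σ_x [2·#(P∩D_F∩D_G) − #(P∩refl D_F∩refl D_G)]`

Support file of the one-cut programme (crux `NoHeavyLowerTail`, stmt-CriticalPhenomena-4575; TRI lane of cell `prim-masterthm`, seat P5 gen 30;
memo `FROM-prim-masterthm-p5-g30-STRATA.md` §1).  Companion of `…SahiCombTriWIdxSplit` (the X-peel identity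
`TRI_a = TRI_{a−1}(F⁰,G⁰) + TRI_{a−1}(F¹,G¹) + Σ_x [#(P∩D_F(x)∩refl D_G(xᶜ)) + #(P∩refl D_F(x)∩D_G(xᶜ)) − #(P∩refl D_F(x)∩refl D_G(xᶜ))]`).

Here the two index faces are paired CROSSWISE: on the index cube `Finset (Option β)` write `F⁰ = F ∘ map some`, `F¹ = F ∘ insertNone`
(so `F⁰ x ⊆ F¹ x` for monotone `F`) and `D_F(x) = F¹ x ∖ F⁰ x` for the index shell at `x`.  Then, for all `P` and all monotone `F, G`
(no up-set hypotheses needed),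

  `triW P F G = triW P F⁰ G¹ + triW P F¹ G⁰ + Σ_{x : Finset β} [ 2·#(P ∩ D_F(x) ∩ D_G(x)) − #(P ∩ refl D_F(x) ∩ refl D_G(x)) ]`

(`triW_idx_mixed_split`).  Unlike the X-peel remainder, this remainder involves the two shells at the SAME index `x`; the mixed pairs
`(F⁰,G¹)` and `(F¹,G⁰)` are again monotone families, and the cross demand classes of the `a`-system are exactly the cross classes of the two
mixed `(a−1)`-systems (memo §1: the supplies rearrange as `2·L_(x,0) + 2·L_(x,1) = 2·F⁰G¹ + 2·F¹G⁰ + 2·D_FD_G` pointwise).  Iterating the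
identity down to `a = 0` gives `TRI_a = Σ_x [Kl_P(G_{xᶜ};F_x) + Kl_P(F_x;G_{xᶜ})] + 2·NET(P) − NET(refl P)` with `a·2^{a−1}` rectangle classes.

* `FiveUpSet.card_inter_sdiff_mid` — `#(S ∩ (B∖A) ∩ T) = #(S ∩ B ∩ T) − #(S ∩ A ∩ T)` for `A ⊆ B`;
* `FiveUpSet.triWTerm_idx_mixed_split` — the termwise identity at `x.map some` and `insertNone x`;
* **`FiveUpSet.triW_idx_mixed_split`** — the summed identity.
HONEST LABEL: identities only (std axioms); `TriWIneq` itself stays OPEN. [this work]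
-/

namespace Summit.CriticalPhenomena.PercolationContinuityZ3.Theorems

namespace FiveUpSet

open Finset

variable {β γ : Type} [DecidableEq β] [Fintype β] [DecidableEq γ] [Fintype γ]

omit [Fintype γ] in
/-- `#(S ∩ (B ∖ A) ∩ T) = #(S ∩ B ∩ T) − #(S ∩ A ∩ T)` (as integers) for `A ⊆ B`. [folklore] -/
theorem card_inter_sdiff_mid (S A B T : Finset (Finset γ)) (h : A ⊆ B) :
    ((S ∩ (B \ A) ∩ T).card : ℤ) = (S ∩ B ∩ T).card - (S ∩ A ∩ T).card := by
  have hu : S ∩ B ∩ T = (S ∩ (B \ A) ∩ T) ∪ (S ∩ A ∩ T) := by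
    ext s
    simp only [mem_inter, mem_union, mem_sdiff]
    constructor
    · rintro ⟨⟨hs, hb⟩, ht⟩
      by_cases ha : s ∈ A
      · exact Or.inr ⟨⟨hs, ha⟩, ht⟩
      · exact Or.inl ⟨⟨hs, hb, ha⟩, ht⟩
    · rintro (⟨⟨hs, hb, -⟩, ht⟩ | ⟨⟨hs, ha⟩, ht⟩)
      · exact ⟨⟨hs, hb⟩, ht⟩
      · exact ⟨⟨hs, h ha⟩, ht⟩
  have hd : Disjoint (S ∩ (B \ A) ∩ T) (S ∩ A ∩ T) := by
    rw [disjoint_left]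
    intro s h1 h2
    simp only [mem_inter, mem_sdiff] at h1 h2
    exact h1.1.2.2 h2.1.2
  rw [hu, card_union_of_disjoint hd]
  push_cast
  ring

/-- `refl` is monotone. [folklore] -/
private theorem refl_mono {𝒜 ℬ : Finset (Finset γ)} (h : 𝒜 ⊆ ℬ) : refl 𝒜 ⊆ refl ℬ := by
  intro s hs
  rw [mem_refl] at hs ⊢
  exact h hs

/-- **Mixed index split, termwise.**  For families `F, G` on the index cube `Finset (Option β)` with `F (x.map some) ⊆ F (insertNone x)` and
`G (x.map some) ⊆ G (insertNone x)` (true for monotone families), writing `D_F = F (insertNone x) ∖ F (x.map some)`,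
`D_G = G (insertNone x) ∖ G (x.map some)`:
`triWTerm P F G (x.map some) + triWTerm P F G (insertNone x)
   = triWTerm P F⁰ G¹ x + triWTerm P F¹ G⁰ x + 2·#(P ∩ D_F ∩ D_G) − #(P ∩ refl D_F ∩ refl D_G)`
(`F⁰ = F ∘ map some`, `F¹ = F ∘ insertNone`, `G⁰`, `G¹` likewise). [this work] -/
theorem triWTerm_idx_mixed_split (P : Finset (Finset γ)) (F G : Finset (Option β) → Finset (Finset γ)) (x : Finset β)
    (hF : F (x.map Function.Embedding.some) ⊆ F (Finset.insertNone x))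
    (hG : G (x.map Function.Embedding.some) ⊆ G (Finset.insertNone x)) :
    triWTerm P F G (x.map Function.Embedding.some) + triWTerm P F G (Finset.insertNone x)
      = triWTerm P (fun y => F (y.map Function.Embedding.some)) (fun y => G (Finset.insertNone y)) x
        + triWTerm P (fun y => F (Finset.insertNone y)) (fun y => G (y.map Function.Embedding.some)) x
        + (2 * ((P ∩ (F (Finset.insertNone x) \ F (x.map Function.Embedding.some))
                  ∩ (G (Finset.insertNone x) \ G (x.map Function.Embedding.some))).card : ℤ)
           - (P ∩ refl (F (Finset.insertNone x) \ F (x.map Function.Embedding.some))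
                  ∩ refl (G (Finset.insertNone x) \ G (x.map Function.Embedding.some))).card) := by
  -- the four inclusion–exclusion facts `#(S∩B∩T) − #(S∩A∩T) = #(S∩(B∖A)∩T)` that are needed
  have e1 := card_inter_sdiff_mid (P ∩ F (x.map Function.Embedding.some)) (G (x.map Function.Embedding.some)) (G (Finset.insertNone x)) univ hG
  have e2 := card_inter_sdiff_mid (P ∩ refl (F (x.map Function.Embedding.some))) (refl (G (x.map Function.Embedding.some)))
    (refl (G (Finset.insertNone x))) univ (refl_mono hG)
  have e3 := card_inter_sdiff_mid (P ∩ F (Finset.insertNone x)) (G (x.map Function.Embedding.some)) (G (Finset.insertNone x)) univ hG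
  have e4 := card_inter_sdiff_mid (P ∩ refl (F (Finset.insertNone x))) (refl (G (x.map Function.Embedding.some)))
    (refl (G (Finset.insertNone x))) univ (refl_mono hG)
  -- and the two `F`-direction facts on the shell of `G`
  have e5 := card_inter_sdiff_mid P (F (x.map Function.Embedding.some)) (F (Finset.insertNone x))
    (G (Finset.insertNone x) \ G (x.map Function.Embedding.some)) hF
  have e6 := card_inter_sdiff_mid P (refl (F (x.map Function.Embedding.some))) (refl (F (Finset.insertNone x)))
    (refl (G (Finset.insertNone x) \ G (x.map Function.Embedding.some))) (refl_mono hF)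
  simp only [inter_univ] at e1 e2 e3 e4
  rw [← refl_sdiff] at e2 e4
  rw [← refl_sdiff] at e6
  unfold triWTerm
  rw [compl_map_some, compl_insertNone]
  push_cast
  linarith [e1, e2, e3, e4, e5, e6]

/-- **The mixed index split of `TRI_W`.**  For monotone families `F, G` on the index cube `Finset (Option β)`, any cube `Finset γ` and any
test family `P`:
`triW P F G = triW P F⁰ G¹ + triW P F¹ G⁰ + Σ_x [ 2·#(P ∩ D_F(x) ∩ D_G(x)) − #(P ∩ refl D_F(x) ∩ refl D_G(x)) ]`
with `F⁰ = F ∘ map some`, `F¹ = F ∘ insertNone`, `D_F(x) = F¹ x ∖ F⁰ x` (and likewise for `G`). [this work] -/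
theorem triW_idx_mixed_split (P : Finset (Finset γ)) (F G : Finset (Option β) → Finset (Finset γ)) (hFm : Monotone F) (hGm : Monotone G) :
    triW P F G = triW P (fun x => F (x.map Function.Embedding.some)) (fun x => G (Finset.insertNone x))
      + triW P (fun x => F (Finset.insertNone x)) (fun x => G (x.map Function.Embedding.some))
      + ∑ x : Finset β, ((2 * ((P ∩ (F (Finset.insertNone x) \ F (x.map Function.Embedding.some))
                  ∩ (G (Finset.insertNone x) \ G (x.map Function.Embedding.some))).card : ℤ)
           - (P ∩ refl (F (Finset.insertNone x) \ F (x.map Function.Embedding.some))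
                  ∩ refl (G (Finset.insertNone x) \ G (x.map Function.Embedding.some))).card)) := by
  unfold triW
  rw [sum_finset_option_idx, ← sum_add_distrib, ← sum_add_distrib, ← sum_add_distrib]
  refine sum_congr rfl fun x _ => ?_
  exact triWTerm_idx_mixed_split P F G x (hFm (map_some_subset_insertNone x)) (hGm (map_some_subset_insertNone x))

end FiveUpSet

end Summit.CriticalPhenomena.PercolationContinuityZ3.Theorems
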